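import Summits.HodgeConjecture.HodgeConjecture.Theorems.R90S6GLCartanBasisExpansion   -- ★ (C.1)(C.2)(H.1-gen) `eq_sum_doubleCosetCoeff_smul_cartan` (+ ★ (H.0) `doubleCosetCoeff_mul_eq_ncard`)
import Literature.NumberTheory.Automorphic.SatakeParametersModP                      -- ★ `heckeDiag_mk0_eq_zpowDiagGL`, `heckeDiag_mk0_self_eq_zpowDiagGL_one` (`t_r = ϖ^{𝟙_{i<r}}`)
import Literature.NumberTheory.Automorphic.HeckeDoubleCosetOperators                 -- ★ `doubleCosetOperator_central_mul` (Shimura Prop. 3.17)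
import HarnessLib

/-!
# R90 · S6 «Ch. 14.1–14.5 stable TF» — WAVE 10 card W10-f (H.1)(H.2): THE `GL₃` PIERI RULE `c_μ · T_r = Σ_λ N_r(μ, λ) • c_λ` IN THE CARTAN BASIS,
# SUPPORT AS A BINDER (`Theorems/R90S6GLThreePieri.lean`; row E1.4.4.2.3 «bφ_λ = Σ_m c_{λ,m} φ_m», GL side)

Cell `hodgecm-mathlib`, crux H413 (`stmt-HodgeConjecture-24833`), route of record `HCCMUnconditional`; programme R90-TF, section S6 (base `R90-C14`),
seat R90-C14-p06 (g0); S6 dealer R90-C14-plan (g2) CARD W10-f + RULING R1 (R90 bus 2026-09-05T00:45:01Z ∕ 00:49:11Z: coefficients ON PATH at `n = 3`,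
`r ∈ {1, 2}`), junction with R90-C14-p10 (g0) SETTLED 01:03:39Z (the count letter, stated INLINE on both sides, no `def`):
`N_r(μ, λ) = pieriCount r μ λ := #{γ ∈ K₀·t_rK₀ ∕ K₀ : γ̃⁻¹ ϖ^λ ∈ K₀ ϖ^μ K₀}` (`K₀ = GL₃(𝒪)`, `t_r = diag(ϖ1_r, 1_{3−r})`, `γ̃ = γ.out`), and dealer word
01:19:53Z «keep `hS_r` a BINDER in `R90S6GLThreePieri.lean` (discharged by name when L3 ★; do not wait on p10)».  Sequel of ★ `R90S6HeckeProductCoordinates`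
(p863957, (H.0): the coordinate of `c_μ · T_r` at `K₀ϖ^λK₀` IS `N_r(μ, λ)`, definitionally the junction letter) and ★ `R90S6GLCartanBasisExpansion` (p864055,
(H.1-gen): expansion with prescribed antitone support).  Lane `--supports stmt-HodgeConjecture-24833 --as helper`; THEOREMS ONLY (no definition, no instance,
no notation, no named fact, no `sorry`); letters = ★ p09's GL side (`{K : Type u} [Field K] [ValuativeRel K] [IsDiscreteValuationRing 𝒪[K]] {ϖ}
(hϖ : IsUniformizingElement ϖ)`, `[IsHeckeTriple ⊤ (glInt 3 K) (glInt 3 K)]`), Cartan classes `c_ν := heckeAlgebra.doubleCosetOperator (glInt 3 K) (zpowDiagGL hϖ.ne_zero ν)`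
with `ν : Fin 3 → ℤ` ANTITONE (p09 ∕ p10 convention), `T_r := heckeAlgebra.doubleCosetOperator (glInt 3 K) (heckeDiag 3 (Units.mk0 ϖ hϖ.ne_zero) r)`.

§1 `GL₃` CARTAN LETTERS (no support input): `heckeDiag_one_eq_zpowDiagGL_single` (`t₁ = ϖ^{e₀}`), `heckeDiag_two_eq_zpowDiagGL` (`t₂ = ϖ^{𝟙 − e₂}`),
`heckeDiag_three_eq_zpowDiagGL_one` (`t₃ = ϖ^{𝟙}`), **`doubleCosetOperator_zpowDiagGL_add_one`** (central shift `c_{ν + 𝟙} = T₃ · c_ν`, the dealer's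
«`c_{(a,b,1)} = T₃ · c_{(a−1,b−1,0)}`», ★ `doubleCosetOperator_central_mul`), `doubleCosetOperator_zpowDiagGL_zero` (`c_0 = 1`) — any `CommRing k`.

§2 THE PIERI RULE WITH THE SUPPORT AS A BINDER (any `CommRing k`; the vertical `r`-strips on `μ` are indexed by the ADDED row `i` for `r = 1`, `λ = μ + e_i`, and by
the OMITTED row `i` for `r = 2`, `λ = μ + 𝟙 − e_i`; only the antitone ones are Cartan classes and enter the sum):
* **`doubleCosetOperator_zpowDiagGL_mul_heckeDiag_one_three`** — (H.1) `c_μ · T₁ = Σ_{i : μ + e_i antitone} (N₁(μ, μ + e_i) : k) • c_{μ + e_i}` given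
  `hS : ∀ ν antitone, N₁(μ, ν) ≠ 0 → ∃ i, ν = μ + e_i`;
* **`doubleCosetOperator_zpowDiagGL_mul_heckeDiag_two_three`** — (H.2) `c_μ · T₂ = Σ_{i : μ + 𝟙 − e_i antitone} (N₂(μ, μ + 𝟙 − e_i) : k) • c_{μ + 𝟙 − e_i}` given
  `hS : ∀ ν antitone, N₂(μ, ν) ≠ 0 → ∃ i, ν = μ + 𝟙 − e_i`;
* **`heckeDiag_one_mul_doubleCosetOperator_zpowDiagGL_three`**, **`heckeDiag_two_mul_…`** — the same with `T_r · c_μ` on the left, over `ℂ` and `[Finite 𝓀[K]]`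
  (★ `heckeAlgebra_gl_mul_comm`), the dealer's orientation «`T_r * c_{(a,b,0)}`».
The binders `hS` are p10's (S)∕(P1)∕(P2) of `Theorems/R90S6GLThreePieriCounts.lean` read contrapositively (all Iverson brackets off ⇒ `N_r = 0`); the sequel discharges
them BY NAME and substitutes p10's closed forms (`N₁(μ, μ+e₀) = 1`, `N₁(μ, μ+e₁) = q + [μ₀ = μ₁+1]`, `N₁(μ, μ+e₂) = q² + [μ₁ = μ₂+1]·q + [μ₀ = μ₁ = μ₂+1]`, and the
`r = 2` twins; `q = #𝓀[K]`).  KILL-CHECKS the explicit forms must pass (Macdonald II (4.6) ∕ V (2.6), PDF p0164, confirmed by the dealer and p10 01:03Z):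
`T₁ · T₁ = c_{(2,0,0)} + (q + 1) • c_{(1,1,0)}`, `T₁ · T₂ = c_{(2,1,0)} + (q² + q + 1) • c_{(1,1,1)}`.

HONEST LABEL: Hecke-algebra bookkeeping for E1.4.4.2.3, count-neutral until the BC identity consumes the Pieri layer; the support binders are OPEN here (p10's L3);
HC_CM is proved only modulo the 7 printed citations (2 remaining named inputs: hLiu418 = stmt-HodgeConjecture-24832, h413 = stmt-HodgeConjecture-24833) until
rung 0 closes; REL ≠ ★ ≠ BUILT.

## References
* [Macdonald1995] I. G. Macdonald, *Symmetric Functions and Hall Polynomials*, 2nd ed. (1995), Ch. II (4.2)–(4.6) (Pieri for Hall–Littlewood, `g^λ_{μ(1^r)}`),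
  Ch. V (2.6) (`ℋ(GL_n, GL_n(𝒪)) ≅` Hall algebra, `c_μ c_ν = Σ g^λ_{μν}(q) c_λ`), (2.5) (central classes).
* [ShimuraIATAF1971] G. Shimura, *Introduction to the Arithmetic Theory of Automorphic Functions* (1971), Prop. 3.17 (central twist), Thm. 3.20–3.21 (`t_r`).
* [AndrianovZhuravlev2015] Ch. 3 §1.1 Lemma 1.5 (structure constants).
-/

set_option autoImplicit false
-- the mandated namespace repeats the single-problem summit's segment (`HodgeConjecture.HodgeConjecture`)
set_option linter.dupNamespace false

noncomputable section

open MulAction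
open Literature.NumberTheory.Automorphic
open scoped MatrixGroups
open ValuativeRel

namespace Summit.HodgeConjecture.HodgeConjecture.R90.S6

universe u

/-! ## §1 `GL₃` Cartan letters -/

section CartanLetters

variable {K : Type u} [Field K] [ValuativeRel K] {ϖ : K} (hϖ : IsUniformizingElement ϖ)

/-- `t₁ = diag(ϖ, 1, 1) = ϖ^{e₀}`. [cite: ShimuraIATAF1971, Thm. 3.20] -/
theorem heckeDiag_one_eq_zpowDiagGL_single : heckeDiag 3 (Units.mk0 ϖ hϖ.ne_zero) 1 = zpowDiagGL hϖ.ne_zero (Pi.single 0 1) := by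
  rw [heckeDiag_mk0_eq_zpowDiagGL]
  congr 1
  funext i
  fin_cases i <;> rfl

/-- `t₂ = diag(ϖ, ϖ, 1) = ϖ^{𝟙 − e₂}`. [cite: ShimuraIATAF1971, Thm. 3.20] -/
theorem heckeDiag_two_eq_zpowDiagGL : heckeDiag 3 (Units.mk0 ϖ hϖ.ne_zero) 2 = zpowDiagGL hϖ.ne_zero (1 - Pi.single 2 1) := by
  rw [heckeDiag_mk0_eq_zpowDiagGL]
  congr 1
  funext i
  fin_cases i <;> rfl

/-- `t₃ = ϖ · 1₃ = ϖ^{𝟙}`. [cite: ShimuraIATAF1971, Thm. 3.20] -/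
theorem heckeDiag_three_eq_zpowDiagGL_one : heckeDiag 3 (Units.mk0 ϖ hϖ.ne_zero) 3 = zpowDiagGL hϖ.ne_zero 1 := by
  rw [heckeDiag_mk0_self_eq_zpowDiagGL_one]
  rfl

variable [IsHeckeTriple (⊤ : Submonoid (GL (Fin 3) K)) (glInt 3 K) (glInt 3 K)] {k : Type*} [CommRing k]

/-- **CENTRAL SHIFT `c_{ν + 𝟙} = T₃ · c_ν`** (`T₃ = 1_{K₀ ϖ K₀}`, `ϖ 1₃` central, `K₀ϖK₀ = ϖK₀` a single coset; the dealer's «`c_{(a,b,1)} = T₃ · c_{(a−1,b−1,0)}`»), any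
`CommRing k`, any `ν`. [cite: ShimuraIATAF1971, Prop. 3.17] [cite: Macdonald1995, Ch. V (2.5)] -/
theorem doubleCosetOperator_zpowDiagGL_add_one (ν : Fin 3 → ℤ) :
    heckeAlgebra.doubleCosetOperator (k := k) (glInt 3 K) (zpowDiagGL hϖ.ne_zero (ν + 1)) =
      heckeAlgebra.doubleCosetOperator (glInt 3 K) (heckeDiag 3 (Units.mk0 ϖ hϖ.ne_zero) 3) *
        heckeAlgebra.doubleCosetOperator (glInt 3 K) (zpowDiagGL hϖ.ne_zero ν) := by
  rw [heckeDiag_mk0_self_eq_zpowDiagGL_one, heckeAlgebra.doubleCosetOperator_central_mul (glInt 3 K)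
    (fun x => mul_zpowDiagGL_const_comm hϖ.ne_zero (1 : ℤ) x), ← zpowDiagGL_add]
  congr 2
  funext i
  simp only [Pi.add_apply, Pi.one_apply, add_comm]

/-- `c_0 = 1_{K₀} = 1`. [cite: Macdonald1995, Ch. V (2.6)] -/
theorem doubleCosetOperator_zpowDiagGL_zero :
    heckeAlgebra.doubleCosetOperator (k := k) (glInt 3 K) (zpowDiagGL hϖ.ne_zero (0 : Fin 3 → ℤ)) = 1 := by
  rw [zpowDiagGL_zero, heckeAlgebra.doubleCosetOperator_one]

end CartanLetters

/-! ## §2 The Pieri rule with the support as a binder -/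

section Pieri

variable {K : Type u} [Field K] [ValuativeRel K] [IsDiscreteValuationRing 𝒪[K]] {ϖ : K} (hϖ : IsUniformizingElement ϖ)
  [IsHeckeTriple (⊤ : Submonoid (GL (Fin 3) K)) (glInt 3 K) (glInt 3 K)] {k : Type*} [CommRing k]

/-- `i ↦ μ + e_i` is injective. [folklore] -/
private theorem add_single_one_injective (μ : Fin 3 → ℤ) :
    Function.Injective fun i : Fin 3 => μ + Pi.single i (1 : ℤ) := by
  intro i j h
  by_contra hne
  have h1 := congr_fun h i
  simp only [Pi.add_apply, Pi.single_eq_same, Pi.single_eq_of_ne hne, add_right_inj] at h1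
  exact one_ne_zero h1

/-- `i ↦ μ + 𝟙 − e_i` is injective. [folklore] -/
private theorem add_one_sub_single_injective (μ : Fin 3 → ℤ) :
    Function.Injective fun i : Fin 3 => μ + 1 - Pi.single i (1 : ℤ) := by
  intro i j h
  by_contra hne
  have h1 := congr_fun h i
  simp only [Pi.sub_apply, Pi.add_apply, Pi.one_apply, Pi.single_eq_same, Pi.single_eq_of_ne hne, sub_right_inj] at h1
  exact one_ne_zero h1

/-- **(H.1) `GL₃` PIERI RULE, `r = 1`, support as a binder**: `c_μ · T₁ = Σ_{i : μ + e_i antitone} N₁(μ, μ + e_i) • c_{μ + e_i}` — the coordinates of `c_μ · T₁` are the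
counts `N₁(μ, ·)` (★ (H.0)), every antitone exponent with a non-zero count is `μ + e_i` (binder `hS` = p10's support theorem), and (H.1-gen) assembles.  Any `CommRing k`.
[cite: Macdonald1995, Ch. II (4.2)–(4.6), Ch. V (2.6)] -/
theorem doubleCosetOperator_zpowDiagGL_mul_heckeDiag_one_three (μ : Fin 3 → ℤ)
    (hS : ∀ ν : Fin 3 → ℤ, Antitone ν →
      ({γ ∈ MulAction.orbit (glInt 3 K) ((heckeDiag 3 (Units.mk0 ϖ hϖ.ne_zero) 1 : GL (Fin 3) K) : GL (Fin 3) K ⧸ glInt 3 K) |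
          ((γ.out⁻¹ * zpowDiagGL hϖ.ne_zero ν : GL (Fin 3) K) : GL (Fin 3) K ⧸ glInt 3 K) ∈
            MulAction.orbit (glInt 3 K) ((zpowDiagGL hϖ.ne_zero μ : GL (Fin 3) K) : _ ⧸ _)}).ncard ≠ 0 →
      ∃ i : Fin 3, ν = μ + Pi.single i 1) :
    heckeAlgebra.doubleCosetOperator (k := k) (glInt 3 K) (zpowDiagGL hϖ.ne_zero μ) *
        heckeAlgebra.doubleCosetOperator (glInt 3 K) (heckeDiag 3 (Units.mk0 ϖ hϖ.ne_zero) 1) =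
      ∑ i ∈ Finset.univ.filter (fun i : Fin 3 => Antitone (μ + Pi.single i 1)),
        (({γ ∈ MulAction.orbit (glInt 3 K) ((heckeDiag 3 (Units.mk0 ϖ hϖ.ne_zero) 1 : GL (Fin 3) K) : GL (Fin 3) K ⧸ glInt 3 K) |
            ((γ.out⁻¹ * zpowDiagGL hϖ.ne_zero (μ + Pi.single i 1) : GL (Fin 3) K) : GL (Fin 3) K ⧸ glInt 3 K) ∈
              MulAction.orbit (glInt 3 K) ((zpowDiagGL hϖ.ne_zero μ : GL (Fin 3) K) : _ ⧸ _)}).ncard : k) •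
          heckeAlgebra.doubleCosetOperator (glInt 3 K) (zpowDiagGL hϖ.ne_zero (μ + Pi.single i 1)) := by
  classical
  set T := heckeAlgebra.doubleCosetOperator (k := k) (glInt 3 K) (zpowDiagGL hϖ.ne_zero μ) *
    heckeAlgebra.doubleCosetOperator (glInt 3 K) (heckeDiag 3 (Units.mk0 ϖ hϖ.ne_zero) 1) with hT
  -- (H.0): the coordinates of `c_μ · T₁` are the counts
  have hcoef : ∀ ν : Fin 3 → ℤ, heckeAlgebra.doubleCosetCoeff (glInt 3 K) T
      (HeckeCoset.mk (glInt 3 K) (glInt 3 K) ⟨zpowDiagGL hϖ.ne_zero ν, Submonoid.mem_top _⟩) =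
      (({γ ∈ MulAction.orbit (glInt 3 K) ((heckeDiag 3 (Units.mk0 ϖ hϖ.ne_zero) 1 : GL (Fin 3) K) : GL (Fin 3) K ⧸ glInt 3 K) |
          ((γ.out⁻¹ * zpowDiagGL hϖ.ne_zero ν : GL (Fin 3) K) : GL (Fin 3) K ⧸ glInt 3 K) ∈
            MulAction.orbit (glInt 3 K) ((zpowDiagGL hϖ.ne_zero μ : GL (Fin 3) K) : _ ⧸ _)}).ncard : k) := fun ν => by
    rw [hT, doubleCosetCoeff_mul_eq_ncard]
  set E : Finset (Fin 3 → ℤ) := (Finset.univ.filter (fun i : Fin 3 => Antitone (μ + Pi.single i 1))).image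
    fun i => μ + Pi.single i 1 with hE
  have hEanti : ∀ ν ∈ E, Antitone ν := fun ν hν => by
    obtain ⟨i, hi, rfl⟩ := Finset.mem_image.1 hν
    exact (Finset.mem_filter.1 hi).2
  have hsupp : ∀ ν : Fin 3 → ℤ, Antitone ν → heckeAlgebra.doubleCosetCoeff (glInt 3 K) T
      (HeckeCoset.mk (glInt 3 K) (glInt 3 K) ⟨zpowDiagGL hϖ.ne_zero ν, Submonoid.mem_top _⟩) ≠ 0 → ν ∈ E := fun ν hν h => by
    rw [hcoef] at h
    obtain ⟨i, rfl⟩ := hS ν hν fun h0 => h (by rw [h0, Nat.cast_zero])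
    exact Finset.mem_image_of_mem _ (Finset.mem_filter.2 ⟨Finset.mem_univ _, hν⟩)
  refine (eq_sum_doubleCosetCoeff_smul_cartan hϖ T E hEanti hsupp).trans ?_
  rw [hE, Finset.sum_image fun i _ j _ h => add_single_one_injective μ h]
  refine Finset.sum_congr rfl fun i _ => ?_
  rw [hcoef]

/-- **(H.2) `GL₃` PIERI RULE, `r = 2`, support as a binder**: `c_μ · T₂ = Σ_{i : μ + 𝟙 − e_i antitone} N₂(μ, μ + 𝟙 − e_i) • c_{μ + 𝟙 − e_i}` (the vertical
2-strips on `μ` indexed by the OMITTED row `i`).  Any `CommRing k`. [cite: Macdonald1995, Ch. II (4.2)–(4.6), Ch. V (2.6)] -/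
theorem doubleCosetOperator_zpowDiagGL_mul_heckeDiag_two_three (μ : Fin 3 → ℤ)
    (hS : ∀ ν : Fin 3 → ℤ, Antitone ν →
      ({γ ∈ MulAction.orbit (glInt 3 K) ((heckeDiag 3 (Units.mk0 ϖ hϖ.ne_zero) 2 : GL (Fin 3) K) : GL (Fin 3) K ⧸ glInt 3 K) |
          ((γ.out⁻¹ * zpowDiagGL hϖ.ne_zero ν : GL (Fin 3) K) : GL (Fin 3) K ⧸ glInt 3 K) ∈
            MulAction.orbit (glInt 3 K) ((zpowDiagGL hϖ.ne_zero μ : GL (Fin 3) K) : _ ⧸ _)}).ncard ≠ 0 →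
      ∃ i : Fin 3, ν = μ + 1 - Pi.single i 1) :
    heckeAlgebra.doubleCosetOperator (k := k) (glInt 3 K) (zpowDiagGL hϖ.ne_zero μ) *
        heckeAlgebra.doubleCosetOperator (glInt 3 K) (heckeDiag 3 (Units.mk0 ϖ hϖ.ne_zero) 2) =
      ∑ i ∈ Finset.univ.filter (fun i : Fin 3 => Antitone (μ + 1 - Pi.single i 1)),
        (({γ ∈ MulAction.orbit (glInt 3 K) ((heckeDiag 3 (Units.mk0 ϖ hϖ.ne_zero) 2 : GL (Fin 3) K) : GL (Fin 3) K ⧸ glInt 3 K) |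
            ((γ.out⁻¹ * zpowDiagGL hϖ.ne_zero (μ + 1 - Pi.single i 1) : GL (Fin 3) K) : GL (Fin 3) K ⧸ glInt 3 K) ∈
              MulAction.orbit (glInt 3 K) ((zpowDiagGL hϖ.ne_zero μ : GL (Fin 3) K) : _ ⧸ _)}).ncard : k) •
          heckeAlgebra.doubleCosetOperator (glInt 3 K) (zpowDiagGL hϖ.ne_zero (μ + 1 - Pi.single i 1)) := by
  classical
  set T := heckeAlgebra.doubleCosetOperator (k := k) (glInt 3 K) (zpowDiagGL hϖ.ne_zero μ) *
    heckeAlgebra.doubleCosetOperator (glInt 3 K) (heckeDiag 3 (Units.mk0 ϖ hϖ.ne_zero) 2) with hT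
  have hcoef : ∀ ν : Fin 3 → ℤ, heckeAlgebra.doubleCosetCoeff (glInt 3 K) T
      (HeckeCoset.mk (glInt 3 K) (glInt 3 K) ⟨zpowDiagGL hϖ.ne_zero ν, Submonoid.mem_top _⟩) =
      (({γ ∈ MulAction.orbit (glInt 3 K) ((heckeDiag 3 (Units.mk0 ϖ hϖ.ne_zero) 2 : GL (Fin 3) K) : GL (Fin 3) K ⧸ glInt 3 K) |
          ((γ.out⁻¹ * zpowDiagGL hϖ.ne_zero ν : GL (Fin 3) K) : GL (Fin 3) K ⧸ glInt 3 K) ∈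
            MulAction.orbit (glInt 3 K) ((zpowDiagGL hϖ.ne_zero μ : GL (Fin 3) K) : _ ⧸ _)}).ncard : k) := fun ν => by
    rw [hT, doubleCosetCoeff_mul_eq_ncard]
  set E : Finset (Fin 3 → ℤ) := (Finset.univ.filter (fun i : Fin 3 => Antitone (μ + 1 - Pi.single i 1))).image
    fun i => μ + 1 - Pi.single i 1 with hE
  have hEanti : ∀ ν ∈ E, Antitone ν := fun ν hν => by
    obtain ⟨i, hi, rfl⟩ := Finset.mem_image.1 hν
    exact (Finset.mem_filter.1 hi).2
  have hsupp : ∀ ν : Fin 3 → ℤ, Antitone ν → heckeAlgebra.doubleCosetCoeff (glInt 3 K) T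
      (HeckeCoset.mk (glInt 3 K) (glInt 3 K) ⟨zpowDiagGL hϖ.ne_zero ν, Submonoid.mem_top _⟩) ≠ 0 → ν ∈ E := fun ν hν h => by
    rw [hcoef] at h
    obtain ⟨i, rfl⟩ := hS ν hν fun h0 => h (by rw [h0, Nat.cast_zero])
    exact Finset.mem_image_of_mem _ (Finset.mem_filter.2 ⟨Finset.mem_univ _, hν⟩)
  refine (eq_sum_doubleCosetCoeff_smul_cartan hϖ T E hEanti hsupp).trans ?_
  rw [hE, Finset.sum_image fun i _ j _ h => add_one_sub_single_injective μ h]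
  refine Finset.sum_congr rfl fun i _ => ?_
  rw [hcoef]

variable [Finite 𝓀[K]]

/-- **(H.1) with `T₁` on the left** (the dealer's orientation «`T₁ * c_{(a,b,0)}`»): over `ℂ`, `ℋ(GL₃(K), GL₃(𝒪))` is commutative (★ `heckeAlgebra_gl_mul_comm`).
[cite: Macdonald1995, Ch. V (2.6)] [cite: CartierCorvallis1979, §IV Thm. 4.1] -/
theorem heckeDiag_one_mul_doubleCosetOperator_zpowDiagGL_three (μ : Fin 3 → ℤ)
    (hS : ∀ ν : Fin 3 → ℤ, Antitone ν →
      ({γ ∈ MulAction.orbit (glInt 3 K) ((heckeDiag 3 (Units.mk0 ϖ hϖ.ne_zero) 1 : GL (Fin 3) K) : GL (Fin 3) K ⧸ glInt 3 K) |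
          ((γ.out⁻¹ * zpowDiagGL hϖ.ne_zero ν : GL (Fin 3) K) : GL (Fin 3) K ⧸ glInt 3 K) ∈
            MulAction.orbit (glInt 3 K) ((zpowDiagGL hϖ.ne_zero μ : GL (Fin 3) K) : _ ⧸ _)}).ncard ≠ 0 →
      ∃ i : Fin 3, ν = μ + Pi.single i 1) :
    heckeAlgebra.doubleCosetOperator (k := ℂ) (glInt 3 K) (heckeDiag 3 (Units.mk0 ϖ hϖ.ne_zero) 1) *
        heckeAlgebra.doubleCosetOperator (glInt 3 K) (zpowDiagGL hϖ.ne_zero μ) =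
      ∑ i ∈ Finset.univ.filter (fun i : Fin 3 => Antitone (μ + Pi.single i 1)),
        (({γ ∈ MulAction.orbit (glInt 3 K) ((heckeDiag 3 (Units.mk0 ϖ hϖ.ne_zero) 1 : GL (Fin 3) K) : GL (Fin 3) K ⧸ glInt 3 K) |
            ((γ.out⁻¹ * zpowDiagGL hϖ.ne_zero (μ + Pi.single i 1) : GL (Fin 3) K) : GL (Fin 3) K ⧸ glInt 3 K) ∈
              MulAction.orbit (glInt 3 K) ((zpowDiagGL hϖ.ne_zero μ : GL (Fin 3) K) : _ ⧸ _)}).ncard : ℂ) •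
          heckeAlgebra.doubleCosetOperator (glInt 3 K) (zpowDiagGL hϖ.ne_zero (μ + Pi.single i 1)) := by
  rw [heckeAlgebra_gl_mul_comm hϖ]
  exact doubleCosetOperator_zpowDiagGL_mul_heckeDiag_one_three hϖ μ hS

/-- **(H.2) with `T₂` on the left**, over `ℂ`. [cite: Macdonald1995, Ch. V (2.6)] [cite: CartierCorvallis1979, §IV Thm. 4.1] -/
theorem heckeDiag_two_mul_doubleCosetOperator_zpowDiagGL_three (μ : Fin 3 → ℤ)
    (hS : ∀ ν : Fin 3 → ℤ, Antitone ν →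
      ({γ ∈ MulAction.orbit (glInt 3 K) ((heckeDiag 3 (Units.mk0 ϖ hϖ.ne_zero) 2 : GL (Fin 3) K) : GL (Fin 3) K ⧸ glInt 3 K) |
          ((γ.out⁻¹ * zpowDiagGL hϖ.ne_zero ν : GL (Fin 3) K) : GL (Fin 3) K ⧸ glInt 3 K) ∈
            MulAction.orbit (glInt 3 K) ((zpowDiagGL hϖ.ne_zero μ : GL (Fin 3) K) : _ ⧸ _)}).ncard ≠ 0 →
      ∃ i : Fin 3, ν = μ + 1 - Pi.single i 1) :
    heckeAlgebra.doubleCosetOperator (k := ℂ) (glInt 3 K) (heckeDiag 3 (Units.mk0 ϖ hϖ.ne_zero) 2) *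
        heckeAlgebra.doubleCosetOperator (glInt 3 K) (zpowDiagGL hϖ.ne_zero μ) =
      ∑ i ∈ Finset.univ.filter (fun i : Fin 3 => Antitone (μ + 1 - Pi.single i 1)),
        (({γ ∈ MulAction.orbit (glInt 3 K) ((heckeDiag 3 (Units.mk0 ϖ hϖ.ne_zero) 2 : GL (Fin 3) K) : GL (Fin 3) K ⧸ glInt 3 K) |
            ((γ.out⁻¹ * zpowDiagGL hϖ.ne_zero (μ + 1 - Pi.single i 1) : GL (Fin 3) K) : GL (Fin 3) K ⧸ glInt 3 K) ∈
              MulAction.orbit (glInt 3 K) ((zpowDiagGL hϖ.ne_zero μ : GL (Fin 3) K) : _ ⧸ _)}).ncard : ℂ) •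
          heckeAlgebra.doubleCosetOperator (glInt 3 K) (zpowDiagGL hϖ.ne_zero (μ + 1 - Pi.single i 1)) := by
  rw [heckeAlgebra_gl_mul_comm hϖ]
  exact doubleCosetOperator_zpowDiagGL_mul_heckeDiag_two_three hϖ μ hS

end Pieri

end Summit.HodgeConjecture.HodgeConjecture.R90.S6

end
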